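/-
Copyright (c) 2026 the pub-hodgecm-mathlib formalisation cell (harness21).  Prover seat hodgecm-mathlib-K2E3-p14 (g3), HCML Track B «K2-LIT» (build stream 29),
h413 = `stmt-HodgeConjecture-24833`, line `K2_E3_EllipticInputs`, unit U12 «Characters», socket #11 road (11-SC), letter (SC-an): brick (T20-f2) «TRANSPORT — AT A
NON-SPLIT PLACE AN ISOTROPIC RANK-3 HERMITIAN FORM HAS THE QUASI-SPLIT MODEL `U(σ_w, Φ₃)(L_w)`» (line lead K2E3-p20 (g3) (T20-f) PLAN `K2/STATUS.md`
2026-09-04T02:03:12Z, open hand (f2); K2E3-p14 (g3) TAKING 02:05:35Z).  2026-09-04.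
-/
import Summits.HodgeConjecture.HodgeConjecture.Theorems.K2E3LocalCarrierWittTransport    -- ★ (E′) p856319: `nonempty_continuousMulEquiv_wittFormOn_relabel`, `…_kernel_one`; brings ★ (E) p856273, ★ `K2E3HermitianWittBasis`, ★ WittDefs ∕ StdFrame, ★ `localNonsplitEquiv`
import Literature.NumberTheory.GelbartRogawski1991.LocalDoubledUnitaryLagrangians         -- ★ `hermForm_reindex`
import Literature.NumberTheory.Automorphic.LocalUnitaryGroupCongr                         -- ★ `antidiagOne_eq_over` (`Φ_N` literal = `(StdForm.antidiagonal N).over`)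
import HarnessLib

/-!
# h413 ∕ Track B «K2-LIT», line `K2_E3_EllipticInputs`, unit U12, road (11-SC), letter (SC-an) — brick (T20-f2): THE QUASI-SPLIT MODEL OF AN ISOTROPIC RANK-3
# HERMITIAN SPACE — `U(σ, H) ≃ₜ* U(σ, Φ₃)` over a field, and `U₃(H)(L⁺_v) ≃ₜ* U(σ_w, Φ₃)(L_w)` at a non-split place where `H_w` is isotropic
# (Dieudonné 1971, Chap. I §11; Platonov–Rapinchuk 1994, §2.3, §5.1; Rogawski 1990, §1.9–§1.10)

Cell `pub/hodgecm-mathlib`, crux H413 = `stmt-HodgeConjecture-24833`, route of record `HCCMUnconditional`; chair K2-lead (g0), dealer K2E3-plan (g2), line lead of the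
(SC-an) ∕ Theorem-20 bricks K2E3-p20 (g3) ((T20-f) PLAN, sub-brick (f2) TRANSPORT).  THEOREMS ONLY (no `def`, no `instance`, no `notation`, no named-fact hypothesis, no `sorry`);
lane `--supports stmt-HodgeConjecture-24833 --as helper`, count-neutral.

WHY.  The Theorem-20 machinery of the line (★ (T20-c) p856564, ★ (T20-e2) p856608, ★ (T20-e1) p856650 ∕ p856672, ★ U3 inputs p856636 ∕ p856669) lives on the one-place FIELD
model `U(σ_w, Φ₃)(L_w)` of the QUASI-SPLIT rank-3 unitary group; the sockets of letter (SC-an) live on the organ's CM carrier `(cmDatum L 3 H).Local v` for an ARBITRARY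
hermitian `H` with unit determinant.  At a non-split `v` (`w ∣ v`, `w̄ = w`) either `H_w` is ANISOTROPIC over `L_w` — then the local group is compact and every regular element is
elliptic (★ `AnisotropicUnitaryGroupCompactOfPlace`), so the non-elliptic clauses of (SC-an) are vacuous — or `H_w` is ISOTROPIC, and THEN `H_w` is similar to `Φ₃`: by Witt's
theorem (★ `K2E3HermitianWittBasis.exists_GL_formCongr_eq_wittMatrix_rev`, `2 ≠ 0`) `ᵗ(σT) H_w T = W(r, H_an)` with `H_an` ANISOTROPIC and `2r + m = 3`; `r = 0` would make
`H_w` anisotropic, so `(r, m) = (1, 1)`, and the relabelling ∕ kernel-normalisation isomorphisms of ★ (E′) p856319 carry `U(σ, W(1, (h)))` onto `U(σ, wittFormOn e₀ (1)) = U(σ, Φ₃)`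
(`wittFormOn_stdWittEquivFin_one_eq_over`).  This file delivers that transport as `Nonempty (… ≃ₜ* …)` statements (Haar ↦ Haar, supercuspidal ↦ supercuspidal along `≃ₜ*`).

* §1 FIELD ALGEBRA (`K` a commutative ring ∕ field with an involution `σ`, `2 ≠ 0`): `eq_zero_of_hermForm_wittFormOn_zero` (a Witt form with `r = 0` is its anisotropic kernel,
  reindexed: it has no isotropic vector), **`exists_formCongr_eq_wittFormOn_one_one`** (an ISOTROPIC non-degenerate σ-hermitian `3 × 3` matrix is congruent to `wittFormOn e (h)`
  with `e : WittIndex 1 1 ≃ Fin 3`, `(h)` σ-hermitian anisotropic), `wittFormOn_stdWittEquivFin_one_eq_over` (`wittFormOn e₀ (1) = Φ₃ = (StdForm.antidiagonal 3).over K` for the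
  STANDARD relabelling `e₀ = stdWittEquivFin 1 1`).
* §2 GROUPS over a topological field: **`nonempty_continuousMulEquiv_unitaryGroup_antidiagonal_of_isotropic`** — `U(σ, H) ≃ₜ* U(σ, (StdForm.antidiagonal 3).over K)`.
* §3 CM DRESS at a non-split `w ∣ v`: **`nonempty_continuousMulEquiv_cmLocal_fieldModel_of_isotropic`** — `(cmDatum L 3 H).Local v ≃ₜ* U(σ_w, (StdForm.antidiagonal 3).over L_w)`
  (★ `localNonsplitEquiv` ∘ §2), and **`nonempty_continuousMulEquiv_cmLocal_antidiagOne_of_isotropic`** — `(cmDatum L 3 H).Local v ≃ₜ* (cmDatum L 3 Φ₃).Local v` with the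
  consumers' literal `Φ₃ = (i, j) ↦ [i + j + 1 = 3]` (★ `antidiagOne_eq_over`, ★ `StdForm.over_map`); plus the trivial dichotomy `isotropic_or_anisotropic`.

HONEST LABEL.  HC_CM is proved only modulo the 7 printed citations (2 remaining named inputs: hLiu418 = `stmt-HodgeConjecture-24832`, h413 = `stmt-HodgeConjecture-24833`)
until rung 0 closes; this file is a count-neutral helper (linear-algebra bookkeeping; nothing printed is asserted as a fact).

## References
* [Dieudonne1971GroupesClassiques] J. Dieudonné, *La géométrie des groupes classiques*, 3e éd. (1971), Chap. I §11 (Witt decomposition; a non-degenerate isotropic space contains a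
  hyperbolic plane).
* [PlatonovRapinchuk1994] V. Platonov, A. Rapinchuk, *Algebraic Groups and Number Theory* (1994), §2.3 (similar forms have conjugate unitary groups), §5.1.
* [Rogawski1990] J. D. Rogawski, *Automorphic Representations of Unitary Groups in Three Variables*, Ann. of Math. Stud. 123 (1990), §1.9–§1.10 pp. 8–9 (the quasi-split `U(2,1)`
  defined by `Φ₃`; at a non-split place an isotropic `H` gives the quasi-split group).
-/

set_option autoImplicit false
set_option linter.dupNamespace false  -- the mandated namespace repeats the single-problem summit's segment (`HodgeConjecture.HodgeConjecture`)

noncomputable section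

open NumberField IsDedekindDomain
open Literature.NumberTheory.Automorphic Literature.NumberTheory.Automorphic.UnitaryGroup Literature.NumberTheory.GaloisRepresentations
open Summit.HodgeConjecture.HodgeConjecture.Cruxes.H413 Summit.HodgeConjecture.HodgeConjecture.Cruxes.H413.K2E3LocalUnitaryWitt
open scoped Matrix MatrixGroups

namespace Summit.HodgeConjecture.HodgeConjecture.Cruxes.H413.K2E3RankOneIsotropicPhi3Model

/-! ## §1 Field algebra: an isotropic non-degenerate hermitian `3 × 3` matrix has Witt data `(r, m) = (1, 1)` -/

section Algebra

variable {K : Type*} [CommRing K] (σ : K →+* K)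

/-- **A Witt form with NO hyperbolic part (`r = 0`) is anisotropic**: `wittFormOn e Han` on `WittIndex 0 m ≃ n` is the anisotropic kernel `Han` reindexed, so
`⟨y, y⟩ = 0 ⇒ y = 0` (★ `hermForm_reindex` twice: along `e` and along `u ↦ inr (inl u) : Fin m ≃ WittIndex 0 m`). [cite: Dieudonne1971GroupesClassiques, Chap. I §11] -/
theorem eq_zero_of_hermForm_wittFormOn_zero {m : ℕ} {n : Type*} [Fintype n] (e : WittIndex 0 m ≃ n) (Han : Matrix (Fin m) (Fin m) K)
    (han : ∀ x : Fin m → K, hermForm σ Han x x = 0 → x = 0) (y : n → K) (hy : hermForm σ (wittFormOn e Han) y y = 0) : y = 0 := by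
  -- `ι : Fin m ≃ WittIndex 0 m`, `u ↦ inr (inl u)` (the `e`- and `f`-slots are empty)
  let ι : Fin m ≃ WittIndex 0 m :=
    { toFun := fun u => Sum.inr (Sum.inl u)
      invFun := fun z => Sum.elim (fun i : Fin 0 => i.elim0) (Sum.elim (fun u : Fin m => u) (fun j : Fin 0 => j.elim0)) z
      left_inv := fun u => rfl
      right_inv := fun z => by
        rcases z with i | u | j
        · exact i.elim0
        · rfl
        · exact j.elim0 }
  have hW : wittForm 0 Han = Matrix.reindex ι ι Han := by
    ext z z'
    rcases z with i | u | j
    · exact i.elim0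
    · rcases z' with i' | u' | j'
      · exact i'.elim0
      · rfl
      · exact j'.elim0
    · exact j.elim0
  -- along `e`
  have h1 : hermForm σ (wittForm 0 Han) (y ∘ e) (y ∘ e) = 0 := by
    have h := Literature.NumberTheory.GelbartRogawski1991.UnitaryDualPair.LocalSplitting.hermForm_reindex e σ (wittForm 0 Han) (y ∘ e) (y ∘ e)
    have hcomp : (y ∘ e) ∘ e.symm = y := by
      funext i; simp only [Function.comp_apply, Equiv.apply_symm_apply]
    rw [hcomp] at h
    rw [← h]
    exact hy
  -- along `ι`
  have h2 : hermForm σ Han ((y ∘ e) ∘ ι) ((y ∘ e) ∘ ι) = 0 := by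
    have h := Literature.NumberTheory.GelbartRogawski1991.UnitaryDualPair.LocalSplitting.hermForm_reindex ι σ Han ((y ∘ e) ∘ ι) ((y ∘ e) ∘ ι)
    have hcomp : ((y ∘ e) ∘ ι) ∘ ι.symm = y ∘ e := by
      funext z; simp only [Function.comp_apply, Equiv.apply_symm_apply]
    rw [hcomp, ← hW] at h
    rw [← h]
    exact h1
  have h3 := han _ h2
  funext i
  obtain ⟨z, rfl⟩ := e.surjective i
  obtain ⟨u, rfl⟩ := ι.surjective z
  have h4 := congr_fun h3 u
  simpa only [Function.comp_apply, Pi.zero_apply] using h4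

variable {σ}

/-- **WITT DATA OF AN ISOTROPIC RANK-3 FORM**: over a field with `2 ≠ 0` and an involution `σ`, a non-degenerate σ-hermitian `H ∈ M₃(K)` admitting an isotropic vector
(`∃ x ≠ 0, ⟨x, x⟩_H = 0`) is congruent to a Witt normal form with ONE hyperbolic pair and a rank-one anisotropic kernel: `ᵗ(σT)·H·T = wittFormOn e (h)`, `e : WittIndex 1 1 ≃ Fin 3`,
`(h)` σ-hermitian anisotropic — Witt's theorem ★ `exists_GL_formCongr_eq_wittMatrix_rev` gives `2r + m = 3` with an anisotropic kernel, and `r = 0` is excluded because congruence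
carries the isotropic vector of `H` to one of the (then anisotropic) Witt form (`⟨T⁻¹x, T⁻¹x⟩_{ᵗ(σT)HT} = ⟨x, x⟩_H`, `eq_zero_of_hermForm_wittFormOn_zero`).
[cite: Dieudonne1971GroupesClassiques, Chap. I §11] [cite: PlatonovRapinchuk1994, §2.3] -/
theorem exists_formCongr_eq_wittFormOn_one_one {K : Type*} [Field K] {σ : K →+* K} (hσ : ∀ a, σ (σ a) = a) (h2 : (2 : K) ≠ 0)
    {H : Matrix (Fin 3) (Fin 3) K} (hH : (H.map σ)ᵀ = H) (hHd : IsUnit H.det) (hiso : ∃ x : Fin 3 → K, x ≠ 0 ∧ hermForm σ H x x = 0) :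
    ∃ (e : WittIndex 1 1 ≃ Fin 3) (T : GL (Fin 3) K) (Han : Matrix (Fin 1) (Fin 1) K),
      (Han.map σ)ᵀ = Han ∧ (∀ x : Fin 1 → K, hermForm σ Han x x = 0 → x = 0) ∧ formCongr σ T H = wittFormOn e Han := by
  classical
  obtain ⟨r, m, e, T, Han, hN, hHan, han, hW⟩ := K2E3HermitianWittBasis.exists_GL_formCongr_eq_wittMatrix_rev σ H hσ h2 hH hHd
  have hW' : formCongr σ T H = wittFormOn e Han := by rw [hW]; rfl
  rw [Fintype.card_fin] at hN
  -- `r ≠ 0`: otherwise `H` would be anisotropic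
  have hr : r ≠ 0 := by
    rintro rfl
    obtain ⟨x, hx0, hx⟩ := hiso
    set y : Fin 3 → K := ((T⁻¹ : GL (Fin 3) K) : Matrix (Fin 3) (Fin 3) K) *ᵥ x with hy
    have hTy : (T : Matrix (Fin 3) (Fin 3) K) *ᵥ y = x := by
      rw [hy, Matrix.mulVec_mulVec, ← Units.val_mul, mul_inv_cancel, Units.val_one, Matrix.one_mulVec]
    -- `⟨y, y⟩_{ᵗ(σT) H T} = ⟨T y, T y⟩_H = ⟨x, x⟩_H = 0`
    have hcongr : hermForm σ (formCongr σ T H) y y =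
        hermForm σ H ((T : Matrix (Fin 3) (Fin 3) K) *ᵥ y) ((T : Matrix (Fin 3) (Fin 3) K) *ᵥ y) := by
      rw [hermForm_apply, hermForm_apply, formCongr]
      have h1 : (σ ∘ ((T : Matrix (Fin 3) (Fin 3) K) *ᵥ y)) = ((T : Matrix (Fin 3) (Fin 3) K).map σ) *ᵥ (σ ∘ y) := by
        funext i; exact RingHom.map_mulVec σ _ y i
      rw [h1, ← Matrix.mulVec_mulVec, ← Matrix.mulVec_mulVec, Matrix.dotProduct_mulVec, Matrix.vecMul_transpose]
    have hy0 : hermForm σ (wittFormOn e Han) y y = 0 := by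
      rw [← hW', hcongr, hTy]; exact hx
    have hyz : y = 0 := eq_zero_of_hermForm_wittFormOn_zero σ e Han han y hy0
    exact hx0 (by rw [← hTy, hyz, Matrix.mulVec_zero])
  obtain rfl : r = 1 := by omega
  obtain rfl : m = 1 := by omega
  exact ⟨e, T, Han, hHan, han, hW'⟩

/-- **THE STANDARD NORMALISED WITT FORM OF TYPE `(1, 1)` IS `Φ₃`**: for the standard relabelling `e₀ = stdWittEquivFin 1 1` (`e ↦ 0`, `u ↦ 1`, `f ↦ 2`) and the kernel `(1)`,
`wittFormOn e₀ (1) = antidiag(1, 1, 1) = (StdForm.antidiagonal 3).over K` (entrywise: both are `[i + j + 1 = 3]`, ★ `antidiagOne_eq_over'`-shape).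
[cite: Rogawski1990, §1.9–§1.10 pp. 8–9] [cite: Dieudonne1971GroupesClassiques, Chap. I §11] -/
theorem wittFormOn_stdWittEquivFin_one_eq_over {K : Type*} [Field K] (h : 1 + (1 + 1) = 3) :
    wittFormOn (stdWittEquivFin 1 1 h) (Matrix.of fun _ _ : Fin 1 => (1 : K)) = (StdForm.antidiagonal 3).over K := by
  have hJ : ∀ i j : Fin 3, (StdForm.antidiagonal 3).over K i j = if j = Fin.rev i then (1 : K) else 0 := by
    intro i j
    simp only [StdForm.over, Matrix.map_apply, StdForm.antidiagonal_J_apply]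
    split_ifs <;> simp
  -- the values of the standard relabelling: `e ↦ 0`, `u ↦ 1`, `f ↦ 2`
  have hv : ∀ z : WittIndex 1 1, ((stdWittEquivFin 1 1 h) z).val = Sum.elim (fun _ => 0) (Sum.elim (fun _ => 1) (fun _ => 2)) z := by
    intro z
    rw [val_stdWittEquivFin]
    rcases z with i | u | j
    · rw [stdWittEquiv_inl, Fin.val_castAdd, Fin.val_eq_zero]; rfl
    · rw [stdWittEquiv_inr_inl, Fin.val_natAdd, Fin.val_castAdd, Fin.val_eq_zero]; rfl
    · rw [stdWittEquiv_inr_inr, Fin.val_natAdd, Fin.val_natAdd, Fin.val_eq_zero]; rfl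
  have hlt : ∀ z : WittIndex 1 1, Sum.elim (fun _ => 0) (Sum.elim (fun _ => 1) (fun _ => 2)) z < 3 := by
    intro z
    rcases z with i | u | j
    · show 0 < 3; omega
    · show 1 < 3; omega
    · show 2 < 3; omega
  have key : ∀ x y : WittIndex 1 1, ((stdWittEquivFin 1 1 h) y = Fin.rev ((stdWittEquivFin 1 1 h) x)) ↔
      Sum.elim (fun _ => 0) (Sum.elim (fun _ => 1) (fun _ => 2)) y + Sum.elim (fun _ => 0) (Sum.elim (fun _ => 1) (fun _ => 2)) x + 1 = 3 := by
    intro x y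
    have hx := hlt x
    have hy := hlt y
    rw [Fin.ext_iff, Fin.val_rev, hv, hv]
    omega
  -- the rank-one Witt pairing entries `δ_{i, rev j}` on `Fin 1` are `1`
  have hp1 : ∀ i j : Fin 1, wittForm 1 (Matrix.of fun _ _ : Fin 1 => (1 : K)) (Sum.inl i) (Sum.inr (Sum.inr j)) = 1 := fun i j => by
    rw [wittForm_inl_inr_inr, if_pos (Subsingleton.elim _ _)]
  have hp2 : ∀ j i : Fin 1, wittForm 1 (Matrix.of fun _ _ : Fin 1 => (1 : K)) (Sum.inr (Sum.inr j)) (Sum.inl i) = 1 := fun j i => by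
    rw [wittForm_inr_inr_inl, if_pos (Subsingleton.elim _ _)]
  ext i j
  obtain ⟨x, rfl⟩ := (stdWittEquivFin 1 1 h).surjective i
  obtain ⟨y, rfl⟩ := (stdWittEquivFin 1 1 h).surjective j
  rw [wittFormOn_apply, Equiv.symm_apply_apply, Equiv.symm_apply_apply, hJ, if_congr (key x y) rfl rfl]
  rcases x with i | u | j <;> rcases y with i' | u' | j' <;> simp [hp1, hp2]

end Algebra

/-! ## §2 Groups over a topological field: `U(σ, H) ≃ₜ* U(σ, Φ₃)` for `H` isotropic -/

section Group

variable {K : Type*} [Field K] [TopologicalSpace K] [IsTopologicalRing K] {σ : K →+* K}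

/-- **THE QUASI-SPLIT MODEL OF AN ISOTROPIC RANK-3 UNITARY GROUP** (field level): for `H ∈ M₃(K)` σ-hermitian with unit determinant and an isotropic vector (`σ` an involution,
`2 ≠ 0`), `U(σ, H)(K) ≃ₜ* U(σ, Φ₃)(K)` as topological groups — congruence to `wittFormOn e (h)` (§1, ★ `unitaryGroupOfFormCongrOfEq`), relabelling to the standard `e₀` (★ (E′)
`nonempty_continuousMulEquiv_wittFormOn_relabel`), kernel normalisation `(h) ↝ (1)` (★ (E′) `nonempty_continuousMulEquiv_wittFormOn_kernel_one`), and `wittFormOn e₀ (1) = Φ₃`.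
[cite: PlatonovRapinchuk1994, §2.3] [cite: Dieudonne1971GroupesClassiques, Chap. I §11] [cite: Rogawski1990, §1.9–§1.10 pp. 8–9] -/
theorem nonempty_continuousMulEquiv_unitaryGroup_antidiagonal_of_isotropic (hσ : ∀ a, σ (σ a) = a) (h2 : (2 : K) ≠ 0)
    {H : Matrix (Fin 3) (Fin 3) K} (hH : (H.map σ)ᵀ = H) (hHd : IsUnit H.det) (hiso : ∃ x : Fin 3 → K, x ≠ 0 ∧ hermForm σ H x x = 0) :
    Nonempty (↥(unitaryGroupOfForm σ H) ≃ₜ* ↥(unitaryGroupOfForm σ ((StdForm.antidiagonal 3).over K))) := by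
  obtain ⟨e, T, Han, hHan, han, hW⟩ := exists_formCongr_eq_wittFormOn_one_one hσ h2 hH hHd hiso
  have h3 : 1 + (1 + 1) = 3 := rfl
  obtain ⟨φ₁⟩ := K2E3LocalCarrierWittTransport.nonempty_continuousMulEquiv_wittFormOn_relabel σ e (stdWittEquivFin 1 1 h3) Han
  obtain ⟨φ₂⟩ := K2E3LocalCarrierWittTransport.nonempty_continuousMulEquiv_wittFormOn_kernel_one σ (stdWittEquivFin 1 1 h3) Han hHan han
  rw [wittFormOn_stdWittEquivFin_one_eq_over h3] at φ₂
  exact ⟨((unitaryGroupOfFormCongrOfEq σ T H (wittFormOn e Han) hW).symm.trans φ₁).trans φ₂⟩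

omit [TopologicalSpace K] [IsTopologicalRing K] in
/-- The trivial dichotomy used by the (T20-f) assembly: a hermitian form is EITHER anisotropic OR has an isotropic vector. [cite: Dieudonne1971GroupesClassiques, Chap. I §11] -/
theorem isotropic_or_anisotropic {N : ℕ} (H : Matrix (Fin N) (Fin N) K) :
    (∃ x : Fin N → K, x ≠ 0 ∧ hermForm σ H x x = 0) ∨ (∀ x : Fin N → K, hermForm σ H x x = 0 → x = 0) := by
  by_cases h : ∀ x : Fin N → K, hermForm σ H x x = 0 → x = 0
  · exact Or.inr h
  · push Not at h
    obtain ⟨x, hx, hx0⟩ := h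
    exact Or.inl ⟨x, hx0, hx⟩

end Group

/-! ## §3 The CM dress at a non-split place -/

section CM

variable (L : Type) [Field L] [NumberField L] [IsCMField L] (H : Matrix (Fin 3) (Fin 3) L)

/-- **THE QUASI-SPLIT FIELD MODEL OF `U₃(H)(L⁺_v)` AT A NON-SPLIT PLACE WHERE `H_w` IS ISOTROPIC**: for `H ∈ M₃(L)` hermitian (`ᵗH̄ = H`) with unit determinant, `w ∣ v` with
`w̄ = w`, and an isotropic vector of `H_w = placeForm H w` over `L_w`: `(cmDatum L 3 H).Local v ≃ₜ* U(σ_w, Φ₃)(L_w)`, `Φ₃ = (StdForm.antidiagonal 3).over L_w` — the one-place model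
★ `localNonsplitEquiv` followed by §2 (`σ_w` is an involution ★ `galAdicCompletionMap_galAdicCompletionMap_self`, `2 ≠ 0` in characteristic `0`, `H_w` hermitian ★
`placeForm_hermitian_of_smul_eq`, `det H_w` a unit ★ `isUnit_placeForm_of_isUnit_det`).  This is the bridge carrying the Theorem-20 machinery of the line (field model of the
quasi-split group) onto the organ's carrier. [cite: PlatonovRapinchuk1994, §2.3, §5.1] [cite: Rogawski1990, §1.9–§1.10 pp. 8–9] -/
theorem nonempty_continuousMulEquiv_cmLocal_fieldModel_of_isotropic (hH : (H.map (cmConjRingHom L))ᵀ = H) (hHd : IsUnit H.det)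
    {v : HeightOneSpectrum (𝓞 ↥(maximalRealSubfield L))} (w : PlacesOver L v) (hw : IsCMField.complexConj L • w.1 = w.1)
    (hiso : ∃ x : Fin 3 → w.1.adicCompletion L, x ≠ 0 ∧ hermForm (galAdicCompletionMap (L := L) (IsCMField.complexConj L) hw) (placeForm H w.1) x x = 0) :
    Nonempty ((cmDatum L 3 H).Local v ≃ₜ*
      ↥(unitaryGroupOfForm (galAdicCompletionMap (L := L) (IsCMField.complexConj L) hw) ((StdForm.antidiagonal 3).over (w.1.adicCompletion L)))) := by
  haveI : CharZero (w.1.adicCompletion L) := charZero_of_injective_algebraMap (algebraMap L (w.1.adicCompletion L)).injective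
  have hσ : ∀ a : w.1.adicCompletion L,
      galAdicCompletionMap (L := L) (IsCMField.complexConj L) hw (galAdicCompletionMap (L := L) (IsCMField.complexConj L) hw a) = a :=
    fun a => Liu2021.galAdicCompletionMap_galAdicCompletionMap_self (↥(maximalRealSubfield L)) L (IsCMField.complexConj L)
      (AlgEquiv.ext fun x => IsCMField.complexConj_apply_apply L x) hw a
  have hJ : ((placeForm H w.1).map (galAdicCompletionMap (L := L) (IsCMField.complexConj L) hw))ᵀ = placeForm H w.1 :=
    placeForm_hermitian_of_smul_eq (c := IsCMField.complexConj L) w H ((map_cmConjRingHom_eq_map_complexConj L H) ▸ hH) hw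
  have hJu : IsUnit (placeForm H w.1).det := (Matrix.isUnit_iff_isUnit_det _).1 (isUnit_placeForm_of_isUnit_det (J := H) hHd w.1)
  obtain ⟨φ⟩ := nonempty_continuousMulEquiv_unitaryGroup_antidiagonal_of_isotropic hσ two_ne_zero hJ hJu hiso
  exact ⟨(localNonsplitEquiv (IsCMField.complexConj L) H (IsCMField.complexConj_ne_one L) w hw).trans φ⟩

/-- **ISOTROPIC `H` ⇒ THE CARRIER IS THE QUASI-SPLIT CARRIER**: under the same hypotheses, `(cmDatum L 3 H).Local v ≃ₜ* (cmDatum L 3 Φ₃).Local v` with the consumers' literal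
split form `Φ₃ = (i, j) ↦ [i + j + 1 = 3]` over `L` (★ `antidiagOne_eq_over`, ★ `StdForm.over_map`: its `placeForm` at `w` is `(StdForm.antidiagonal 3).over L_w`; then ★
`localNonsplitEquiv` for `Φ₃` backwards). [cite: PlatonovRapinchuk1994, §2.3, §5.1] [cite: Rogawski1990, §1.9–§1.10 pp. 8–9] -/
theorem nonempty_continuousMulEquiv_cmLocal_antidiagOne_of_isotropic (hH : (H.map (cmConjRingHom L))ᵀ = H) (hHd : IsUnit H.det)
    {v : HeightOneSpectrum (𝓞 ↥(maximalRealSubfield L))} (w : PlacesOver L v) (hw : IsCMField.complexConj L • w.1 = w.1)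
    (hiso : ∃ x : Fin 3 → w.1.adicCompletion L, x ≠ 0 ∧ hermForm (galAdicCompletionMap (L := L) (IsCMField.complexConj L) hw) (placeForm H w.1) x x = 0) :
    Nonempty ((cmDatum L 3 H).Local v ≃ₜ* (cmDatum L 3 (Matrix.of fun i j : Fin 3 => if i.val + j.val + 1 = 3 then (1 : L) else 0)).Local v) := by
  obtain ⟨φ⟩ := nonempty_continuousMulEquiv_cmLocal_fieldModel_of_isotropic L H hH hHd w hw hiso
  have hΦ : placeForm (Matrix.of fun i j : Fin 3 => if i.val + j.val + 1 = 3 then (1 : L) else 0) w.1 =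
      (StdForm.antidiagonal 3).over (w.1.adicCompletion L) := by
    rw [UnitaryGroup.antidiagOne_eq_over L 3]
    exact StdForm.over_map _ _
  have ψ := localNonsplitEquiv (IsCMField.complexConj L) (Matrix.of fun i j : Fin 3 => if i.val + j.val + 1 = 3 then (1 : L) else 0)
    (IsCMField.complexConj_ne_one L) w hw
  rw [hΦ] at ψ
  exact ⟨φ.trans ψ.symm⟩

end CM

end Summit.HodgeConjecture.HodgeConjecture.Cruxes.H413.K2E3RankOneIsotropicPhi3Model

end
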